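import Summits.QuantumFields.YangMills.Theorems.BalabanUVNodesN07DbarNearBondReading
import Summits.QuantumFields.YangMills.Theorems.BalabanUVNodesN07DbarDictionaryTransfer
import Summits.QuantumFields.YangMills.Theorems.BalabanUVNodesN07NearRowsAtRecordWideClass
import Summits.QuantumFields.YangMills.Theorems.BalabanUVNodesN07NormalisationDbarFramesWide
import HarnessLib

/-!
# N07 [B11] (= [15] = [Balaban1985Variational]) Sect. F — MODULE 96: **THE TOP NEAR ROWS IN THE DOUBLE-BAR CURRENCY, AT THE RECORD, EVERY LETTER SUPPLIED** — for every top
# constraint bond `c` of print's (150) family `D″ = □ ⊓ Ω(s)` at a meeting, print-margin-clean datum, under the normalisation of record `NrmDbarWideOfRecord` (MODULE 91″):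
# `‖U̿^{(j)}(U^u)♮(c) − 1‖ ≤ r + 2f + 2f·r`, `r = (d−1)·crad·((1+2C_L)·δ_j)` (the rooted axial top row of MODULE 62″ at the representative), `f = 2ℓ·τ_rad(δ_{j−1})` (the block frame at an
# out-end over a DENT-TYPE block of the window, MODULE 94 ∘ 71's within row ∘ 81's data letter) — print's (160), first case, with the frame of [3] (97) at the window's edge

Cell `pub-ymgap`, seat `pub-ymgap-dag-n07-e` g28 (FAN-OUT §N07 row s3; LANE OWNER of the K0 road chart side), MODULE 96 (INTENT-96, cell bus; plan (α⁗-W) step 4 of (c′)‴).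
`--kind proof --supports stmt-QuantumFields-20541 --as helper` (K0⁷); count-neutral; THEOREMS ONLY (0 `def`).  [15] = [Balaban1985Variational]; [3] = [Balaban1985Averaging];
[6] = [Balaban1985RegularSpaces]; [4] = [Balaban1984PropagatorsII]; [III] = [Balaban1988Convergent]; [I] = [Balaban1987RG1].

WHY.  ⚑ LOCATED-OUT-END-FRAME (this lane, 2026-08-29): at a top bond `(y, y′)` of `D″` with `y′ ∉ Ω_j` the double-bar currency charges the block frame `vframeU (U̿^{(j−1)}(U^u)♮) y′`;
under the WINDOW family `D̃` (cure (α⁗-W)) every top end `y′ ∈ Ω_j` is a `D̃`-cell (frame `1`) and every `y′ ∉ Ω_j` is a dent-type block of print's window `□̃` over the data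
`W_{j−1}` (δ-type, print's (160) second case).  This file threads it by name: 93 §3 (the top bond is a `D̃`-constraint bond) → 61's collar dichotomy IN `D̃` → 95 (the Landau copy's
reads under the bond from (T1)∕(T2); the dictionary for `U^u`, transferred to the representative `U″ = U^{h̄w}`) → 94's three readings with `r` := 62″ §1's rooted two-sided Poincaré bound
on the window box (data letter 69b″) and `s_f` := 71's within-block row at `U″` on the out-block (data letter 81, the out-end being a window label OFF `Γ_j`).

WHAT IS PROVED (sorry-free; axioms standard).  §1 `inBox_windowTop_iff` (the top cube of `D̃`'s tower IS print's window `[tLo, tHi]`), `not_mem_seqOm_of_not_mem_wideOm` (a window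
label outside `Ω̃_j` is outside `Ω_j`).  §2 ★★★ `norm_dbar_sub_one_top_le_of_data (F N)` — the header's bound for EVERY top constraint bond of `D″`, hypotheses = MODULE 75∕80's
(separated run, grid, floor, ranges, `δ_N`-guard, data + fibre, meeting + clean datum, non-wrapping, `L ≤ ρ`) + the S3 door's rows (T1)∕(T2) for `(u, A)` at the datum + the
dictionary budgets `12800·ℓ²·κ·ε·L ≤ 1`, `60·ℓ²·κ·ε·L < δ_N` + the frame budget `600ℓ·τ_rad(a₁) ≤ 1` + `NrmDbarWideOfRecord … u A` + `Adm22 D̃ R M_b`, `2L ≤ R·M_b + 1`.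
HONEST SCOPE: by-name composition; every analytic input is a landed module's under its displayed hypotheses; `NrmDbarWideOfRecord`'s door is CONDITIONAL (`HThm4RecDbar`, N05-REC);
(T1)∕(T2) are the door's rows; nothing of [15]∕[6]∕[3]∕[III] ANALYSIS asserted beyond the cited lemmas; (c′)‴ NOT closed here (the dent rows and the `hQnear` adapter follow);
K0⁷ NOT closed; N07 NOT discharged; counts unmoved; one finite 𝕋⁴ programme at fixed ε — the route closes the conditional finite-𝕋⁴ rung `BalabanLadder.UV` ONLY; the YM mass gap (Clay)
is NOT proved by any of this; nothing continuum ∕ ℝ⁴ ∕ OS.  No `def`, no `instance`, no `notation`, no `sorry`.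

References: [15] (7) p. 278, (144) p. 300, (147)–(154) pp. 301–302, (160) p. 303; [3] (11) p. 19, (26) p. 22, (62) p. 28, (87)–(92) p. 31, (97) p. 32, (110) p. 34; [6] Lemma 1 (1.25) p. 79,
p. 98, (1.129) p. 98, (1.131) p. 99; [4] (2.1)–(2.3) p. 224; [III] (2.2), (2.10)–(2.13) pp. 255–257; [I] (0.4), (0.11) p. 253.
-/

set_option autoImplicit false

noncomputable section

open scoped BigOperators Matrix.Norms.L2Operator

namespace Summit.QuantumFields.YangMills.BalabanUVNodes.N07DbarNearRowsTop

open Literature.MathematicalPhysics.QuantumFieldTheory.Balaban1983to89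
open Literature.MathematicalPhysics.QuantumFieldTheory.Balaban1983to89.Node00
open Literature.MathematicalPhysics.QuantumFieldTheory.Balaban1983to89.B15DeterminingSets
open T4Continuum (T4Family)
open T4AxialGaugeSmallField (castSite boxBonds boxPlaqs)
open T4AxialGaugeRooted (axialGaugeAt)
open B12GaugeOrbits021 (IsResidual iter_gaugeAct_of_isResidual)
open B15Eq177GaugeInvariance (blockLift)
open B16Sect1Backgrounds (toMS)
open B15Eq112TorusCover (cover)
open B14DomainGeom (Pt Within)
open B7Prop1Local (InBox)
open B8Eq131Cubes (box cube sqLo sqHi tLo tHi ctr crad ctr_mem)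
open B5Eq118OneStroke (iterBlockOf iterBlockOf_succ)
open B6SectADomainsV1 (Domains)
open B6SectAOperatorsV1 (BondIdx)
open B10Eq27TorusAxialLog (unitsField toUField gaugeActT)
open B12RegularSpaces111 (gaugeU expI)
open GaugeField (gaugeAct)
open ExpMeanLog (expMeanLogSU deltaSU)
open Summit.QuantumFields.Balaban3D.Carriers (radialContourData)
open Summit.QuantumFields.YangMills.Theorems.FlatCubeOpsText (Adm22)
open Summit.QuantumFields.YangMills.Theorems.Prop8Chart (emlIterU expCfg)
open Summit.QuantumFields.YangMills.Theorems.Prop8ChartDoubleBar (vframeU dbarIterU)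
open Summit.QuantumFields.YangMills.BalabanUVNodes.N07NormalisationDbarFrames (toUT)
open Summit.QuantumFields.YangMills.BalabanUVNodes.N07NormalisationDbarFramesWide (NrmDbarWideOfRecord)
open Summit.QuantumFields.YangMills.BalabanUVNodes.N07NormalisationCrossingEnds (lamSite_or_forall_block_of_lamBond_end)
open Summit.QuantumFields.YangMills.BalabanUVNodes.N07NormalisationWideRows (dist1_gaugeAct_axialGaugeAt_le_of_mem_boxBonds abs_sub_ctr_le_crad Icc_chartBox_subset_Icc_printWindow)
open Summit.QuantumFields.YangMills.BalabanUVNodes.N07ShearSizeTopBox (mem_boxBonds_of_ends_mem_box)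
open Summit.QuantumFields.YangMills.BalabanUVNodes.N07PrintWindowDataSmall (plaqSmallOn_printWindow_iter_of_data)
open Summit.QuantumFields.YangMills.BalabanUVNodes.N07ChartTopBoxDataSmall (two_mul_L_lt_sitesPerDir)
open Summit.QuantumFields.YangMills.BalabanUVNodes.N07DentBlockDataSmall (plaqSmallOn_dentBlock_iter_of_data)
open Summit.QuantumFields.YangMills.BalabanUVNodes.N07DentRowsTwoBlocks (dist1_iter_within_le_of_box)
open Summit.QuantumFields.YangMills.BalabanUVNodes.N07RadialAxialTower (radialTower_gaugeAct_blockLift)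
open Summit.QuantumFields.YangMills.BalabanUVNodes.N09AxialSelectionExists (iter_gaugeAct_blockLift)
open Summit.QuantumFields.YangMills.BalabanUVNodes.N07DataDownTheTowerBlowDown (dist1_plaqHol_iter_gaugeAct)
open Summit.QuantumFields.YangMills.BalabanUVNodes.N07NearRowsAtRecordWideClass (not_mem_genSet_of_embIter_not_mem)
open Summit.QuantumFields.YangMills.BalabanUVNodes.N07RecordDomainsAdm22 (blockSat_seqOfRecord)
open Summit.QuantumFields.YangMills.BalabanUVNodes.N07FarRowsOfTowerLetters (exists_collar_labels_of_lamBond_meet)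
open Summit.QuantumFields.YangMills.BalabanUVNodes.N07DbarCrossingEnds (lamBond_wide_of_near)
open Summit.QuantumFields.YangMills.BalabanUVNodes.N07DbarNearBondReading (norm_dbar_sub_one_le_of_cells norm_dbar_sub_one_le_of_outEnd_tgt norm_dbar_sub_one_le_of_outEnd_src)
open Summit.QuantumFields.YangMills.BalabanUVNodes.N07DbarDictionaryTransfer (emlIterU_unitsField_eq_iter_of_reads₂ emlIterU_eq_iter_apply_of_gaugeAct landau_reads_of_tower)

/-! ## §1  The top cube of the window family is print's window; a numeric envelope -/

section Window

variable {P : Params}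

/-- The common envelope of MODULE 94's three readings: `x ≤ r`, `x ≤ r + f + rf` or `x ≤ 2f + r + 2fr` imply `x ≤ r + 2f + 2fr` (`r, f ≥ 0`). [folklore] -/
theorem le_envelope_of_three_cases {x r f : ℝ} (hr : 0 ≤ r) (hf : 0 ≤ f) (h : x ≤ r ∨ x ≤ r + f + r * f ∨ x ≤ 2 * f + r + 2 * f * r) :
    x ≤ r + 2 * f + 2 * f * r := by
  have hrf : 0 ≤ r * f := mul_nonneg hr hf
  rcases h with h | h | h <;> linarith

/-- The top label box of the WIDENED tower (corner `a − ρ`, side `S + 2ρ`, depth `k`, at level `k`) is print's window `[tLo a ρ, tHi a S ρ] = [a − 2ρ, a + S − 1 + 2ρ]` ([6] p. 98).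
[cite: Balaban1985RegularSpaces, p.98, (1.131) p.99; Balaban1985Variational, (144) p.300] -/
theorem inBox_windowTop_of_mem_Icc {a : Pt P.d} {S ρ k : ℕ} {t : Pt P.d} (ht : t ∈ Set.Icc (tLo a ρ) (tHi a S ρ)) :
    InBox (sqLo P.L (a - ((ρ : ℕ) : Pt P.d)) ρ k k) (sqHi P.L (a - ((ρ : ℕ) : Pt P.d)) (S + 2 * ρ) ρ k k) t := by
  intro i
  have h1 := ht.1 i
  have h2 := ht.2 i
  simp only [tLo, tHi] at h1 h2
  simp only [sqLo, sqHi, B8Eq131Cubes.bLo, B8Eq131Cubes.bHi, Nat.sub_self, B8Eq131Cubes.gs_zero, pow_zero, one_mul, mul_one, Pi.sub_apply, Pi.natCast_apply]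
  push_cast
  constructor <;> linarith

variable {F : T4Family}

/-- ★ **A WINDOW LABEL OUTSIDE `Ω̃_j = □̃_j ∩ Ω_j` IS OFF `Γ_j`**: at the datum `(j, idx)` (`1 ≤ j ≤ k`, nested + block-saturated run), a label `t ∈ [tLo, tHi]` with `π_j t ∉ D̃.Om j`
has `π_j t ∉ (domainsOfSeq s.Ω j).Om j`, hence `castSite t ∉ genSet s.Ω k j` (MODULE 80's key). [cite: Balaban1988Convergent, (2.2) p.255, (2.10)–(2.12) p.256; Balaban1985Variational, (150) p.301] -/
theorem not_mem_genSet_of_not_mem_wideOm {ν : Stage7Numerics} {M : ℕ} {g : ℕ → ℝ} {K k : ℕ} (s : SeqOfRecord F ν M g K k) (hkK : k ≤ (F.P K).m + (F.P K).K)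
    (hgrid : ∀ j : ℕ, 1 ≤ j → j ≤ k → dCubeSide (F.P K).L M (RkOfRecord (F.P K).L ν.r (g j)) j ∣ (F.P K).sitesPerDir 0)
    {Mc ρ j : ℕ} (hj1 : 1 ≤ j) (hjk : j ≤ k) (hk : j ≤ (F.P K).m + (F.P K).K) (idx : Pt (F.P K).d) {t : Pt (F.P K).d}
    (ht : t ∈ Set.Icc (tLo (cornerP (F.P K) Mc ρ idx) ρ) (tHi (cornerP (F.P K) Mc ρ idx) (sideP (F.P K) Mc ρ) ρ))
    (hout : coverAt (F.P K) j t ∉ (domainsMeet (cubeDomains (F.P K) (cornerP (F.P K) Mc ρ idx - ((ρ : ℕ) : Pt (F.P K).d)) (sideP (F.P K) Mc ρ + 2 * ρ) ρ j hk)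
      (domainsOfSeq s.Ω j hk)).Om j) :
    (castSite t : Site (F.P K) j) ∉ genSet s.Ω k j := by
  have hcube : coverAt (F.P K) j t ∈ (cubeDomains (F.P K) (cornerP (F.P K) Mc ρ idx - ((ρ : ℕ) : Pt (F.P K).d)) (sideP (F.P K) Mc ρ + 2 * ρ) ρ j hk).Om j :=
    coverAt_mem_cubeDomains_Om hj1 le_rfl (inBox_windowTop_of_mem_Icc ht)
  have hseq : coverAt (F.P K) j t ∉ (domainsOfSeq s.Ω j hk).Om j := fun h => hout ((mem_domainsMeet_Om _ _ j _).2 ⟨hcube, h⟩)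
  have hnest : ∀ i : ℕ, 1 ≤ i → i < j → s.Ω (i + 1) ⊆ s.Ω i := fun i h1 hi => s.chain.Ω_succ_subset_Ω h1 (lt_of_lt_of_le hi hjk)
  have hsat : ∀ (j' : ℕ) (x x' : Site (F.P K) 0), 1 ≤ j' → j' ≤ j → iterBlockOf j' x = iterBlockOf j' x' → x ∈ s.Ω j' → x' ∈ s.Ω j' :=
    fun j' x x' h1 hj' => blockSat_seqOfRecord F ν M g K k hkK s hgrid j' x x' h1 (hj'.trans hjk)
  refine not_mem_genSet_of_embIter_not_mem s.Ω hj1 hjk fun hmem => hseq ?_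
  exact (mem_domainsOfSeq_Om_iff_centre s.Ω hk hnest hsat hj1 le_rfl _).2 hmem

end Window

/-! ## §2  The top near rows in the double-bar currency -/

section Record

variable (F : T4Family) (N : ℕ) [NeZero N]

/-- ★★★ **THE TOP NEAR ROWS OF `U̿^{(j)}(U^u)♮` AT THE RECORD** (statement in the header): for every top constraint bond `c` of `D″` at a meeting, print-margin-clean datum `(m+1, idx)`,
`‖U̿^{(m+1)}(U^u)♮(c) − 1‖ ≤ r + 2f + 2f·r`, `r = (d−1)·crad·((1+2C_L)·δ_{m+1})`, `f = 2ℓ·τ_rad(δ_m)`, `τ_rad(a) = (d(L−1)+1)·((d−1)(L−1)·a)`.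
[cite: Balaban1985Variational, (160) p.303, (147) p.301, (150)–(154) pp.301–302, (7) p.278; Balaban1985Averaging, (87)–(92) p.31, (97) p.32, (110) p.34; Balaban1985RegularSpaces, Lemma 1 (1.25) p.79, p.98, (1.129)–(1.131) pp.98–99; Balaban1984PropagatorsII, (2.1)–(2.3) p.224; Balaban1988Convergent, (2.10)–(2.13) pp.255–257] -/
theorem norm_dbar_sub_one_top_le_of_data {ν : Stage7Numerics} {M : ℕ} {g : ℕ → ℝ} {K k : ℕ} (s : SeqOfRecord F ν M g K k)
    (hsep : Sect2.SeqSeparated ν.M₁ s) (hkK : k ≤ (F.P K).m + (F.P K).K)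
    (hgrid : ∀ j : ℕ, 1 ≤ j → j ≤ k → dCubeSide (F.P K).L M (RkOfRecord (F.P K).L ν.r (g j)) j ∣ (F.P K).sitesPerDir 0)
    {Mc ρ : ℕ} (hMc : 1 ≤ Mc) (hρ : 1 ≤ ρ) (hLρ : (F.P K).L ≤ ρ) (hfloor : (11 * (F.P K).d + 4 * ρ + Mc) * (F.P K).L + 3 ≤ ν.M₁)
    {δ : ℕ → ℝ} {a₁ : ℝ} (hδ : ∀ n, n ≤ k → 0 < δ n ∧ δ n ≤ a₁) (hcompδ : ∀ n, n < k → δ n ≤ 2 * δ (n + 1))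
    (hguard : (((((F.P K).d + 2) * (F.P K).L : ℕ) : ℝ) ^ 2 / 4) * ((4 * (((((F.P K).d - 1 : ℕ) : ℝ)) * ((2 * (F.P K).L - 1 : ℕ) : ℝ)) + 1) * a₁) < deltaSU (Fin N))
    (hτ : 600 * ((((F.P K).d + 2) * (F.P K).L : ℕ) : ℝ) * ((((F.P K).d * ((F.P K).L - 1) + 1 : ℕ) : ℝ) * (((((F.P K).d - 1 : ℕ) : ℝ) * (((F.P K).L - 1 : ℕ) : ℝ)) * a₁)) ≤ 1)
    (W : MSField (F.P K) (SU N)) (h7 : Sect2.DataSmall7PTop (avOfRecord F N K) s.Ω (suppDomOfRecord F ν K s.Ω) k δ W)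
    (U : GaugeField (F.P K) 0 (SU N)) (hfib : AgreeOn (genSet s.Ω k) (avgFamily (avOfRecord F N K) U) W)
    {m : ℕ} (hjk : m + 1 ≤ k) (hjK : m + 1 + 1 ≤ (F.P K).m + (F.P K).K) (idx : Pt (F.P K).d)
    (hmeet : ∃ x ∈ box (F.P K).L (cornerP (F.P K) Mc ρ idx) (sideP (F.P K) Mc ρ) (m + 1), ∃ y : Pt (F.P K).d, cover (F.P K) y ∈ s.Ω (m + 1) ∧ Within ((3 : ℕ) : ℤ) x y)
    (hclean : m + 1 = k ∨ ∀ z ∈ box (F.P K).L (cornerP (F.P K) Mc ρ idx - ((2 * ρ : ℕ) : Pt (F.P K).d)) (sideP (F.P K) Mc ρ + 2 * (2 * ρ)) (m + 1),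
      cover (F.P K) z ∉ s.Ω (m + 1 + 1))
    {n₀ : ℕ} (hn : ∀ κ, (tHi (cornerP (F.P K) Mc ρ idx) (sideP (F.P K) Mc ρ) ρ) κ ≤ (tLo (cornerP (F.P K) Mc ρ idx) ρ) κ + n₀) (hnN : n₀ + 1 < (F.P K).sitesPerDir (m + 1))
    -- the Landau copy `(u, A)` at the datum: the S3 door's rows (T1)∕(T2) and the dictionary budgets
    (u : GaugeTransf (F.P K) 0 (SU N)) (A : PBond (F.P K) 0 → MatA N) {κ ε' : ℝ} (hκ : 0 ≤ κ) (hε' : 0 ≤ ε')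
    (hT1 : ∀ b ∈ (Sect2.regionOfSet (F.P K) (cover (F.P K) '' cube (F.P K).L (cornerP (F.P K) Mc ρ idx) (sideP (F.P K) Mc ρ) ρ (m + 1) 0)).bonds,
      gaugeU (fun x => ιSU N (u x)) (fun b' => ιSU N (U b')) b = expI ((F.P K).eta (m + 1)) (A b))
    (hT2 : ∀ j', j' ≤ m + 1 → ∀ b ∈ (Sect2.regionOfSet (F.P K) (cover (F.P K) '' cube (F.P K).L (cornerP (F.P K) Mc ρ idx) (sideP (F.P K) Mc ρ) ρ (m + 1) j')).bonds,
      ‖A b‖ < κ * ε' * ((F.P K).L : ℝ) ^ (m + 1 - j'))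
    (hbud : 12800 * ((((F.P K).d + 2) * (F.P K).L : ℕ) : ℝ) ^ 2 * (κ * ε' * ((F.P K).L : ℝ)) ≤ 1)
    (hgd : 60 * ((((F.P K).d + 2) * (F.P K).L : ℕ) : ℝ) ^ 2 * (κ * ε' * ((F.P K).L : ℝ)) < deltaSU (Fin N))
    -- the normalisation of record and the (2.2) collar of the WINDOW family `D̃`
    (hk : m + 1 ≤ (F.P K).m + (F.P K).K) (hN : NrmDbarWideOfRecord F N Mc ρ ν M g K k s U (m + 1) idx u A) {R Mb : ℕ}
    (hAdm : Adm22 (domainsMeet (cubeDomains (F.P K) (cornerP (F.P K) Mc ρ idx - ((ρ : ℕ) : Pt (F.P K).d)) (sideP (F.P K) Mc ρ + 2 * ρ) ρ (m + 1) hk)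
      (domainsOfSeq s.Ω (m + 1) hk)) R Mb)
    (hRM : 2 * (F.P K).L ≤ R * Mb + 1)
    -- the top constraint bond of `D″`
    (c : PBond (F.P K) (m + 1))
    (hc : (domainsMeet (cubeDomains (F.P K) (cornerP (F.P K) Mc ρ idx) (sideP (F.P K) Mc ρ) ρ (m + 1) hk) (domainsOfSeq s.Ω (m + 1) hk)).LamBond (m + 1) c) :
    ‖((dbarIterU (m + 1) (unitsField (toUField (gaugeAct u U))) c : (MatA N)ˣ) : MatA N) - 1‖ ≤
      (((F.P K).d - 1 : ℕ) : ℝ) * (crad (sideP (F.P K) Mc ρ) ρ : ℕ) *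
          ((1 + 2 * ((((F.P K).L : ℝ) ^ 2 + 6 * ((((F.P K).d + 2) * (F.P K).L : ℕ) : ℝ) ^ 2) * (4 * (((((F.P K).d - 1 : ℕ) : ℝ)) * ((2 * (F.P K).L - 1 : ℕ) : ℝ)) + 1))) * δ (m + 1)) +
        2 * (2 * ((((F.P K).d + 2) * (F.P K).L : ℕ) : ℝ) * ((((F.P K).d * ((F.P K).L - 1) + 1 : ℕ) : ℝ) * (((((F.P K).d - 1 : ℕ) : ℝ) * (((F.P K).L - 1 : ℕ) : ℝ)) * δ m))) +
        2 * (2 * ((((F.P K).d + 2) * (F.P K).L : ℕ) : ℝ) * ((((F.P K).d * ((F.P K).L - 1) + 1 : ℕ) : ℝ) * (((((F.P K).d - 1 : ℕ) : ℝ) * (((F.P K).L - 1 : ℕ) : ℝ)) * δ m))) *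
          ((((F.P K).d - 1 : ℕ) : ℝ) * (crad (sideP (F.P K) Mc ρ) ρ : ℕ) *
            ((1 + 2 * ((((F.P K).L : ℝ) ^ 2 + 6 * ((((F.P K).d + 2) * (F.P K).L : ℕ) : ℝ) ^ 2) * (4 * (((((F.P K).d - 1 : ℕ) : ℝ)) * ((2 * (F.P K).L - 1 : ℕ) : ℝ)) + 1))) * δ (m + 1))) := by
  -- ### letters (explicit; no `set`, the statement's right side is `r + 2f + 2f·r` literally)
  have hℓ0 : (0 : ℝ) ≤ ((((F.P K).d + 2) * (F.P K).L : ℕ) : ℝ) := Nat.cast_nonneg _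
  have hCL0 : (0 : ℝ) ≤ 1 + 2 * ((((F.P K).L : ℝ) ^ 2 + 6 * ((((F.P K).d + 2) * (F.P K).L : ℕ) : ℝ) ^ 2) *
      (4 * (((((F.P K).d - 1 : ℕ) : ℝ)) * ((2 * (F.P K).L - 1 : ℕ) : ℝ)) + 1)) := by positivity
  have hδj : 0 < δ (m + 1) := (hδ (m + 1) hjk).1
  have hδm : 0 < δ m := (hδ m (by omega)).1
  have hδja : δ (m + 1) ≤ a₁ := (hδ (m + 1) hjk).2
  have hδma : δ m ≤ a₁ := (hδ m (by omega)).2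
  have hX0 : (0 : ℝ) ≤ (((F.P K).d - 1 : ℕ) : ℝ) * (crad (sideP (F.P K) Mc ρ) ρ : ℕ) := by positivity
  have hr0 : (0 : ℝ) ≤ (((F.P K).d - 1 : ℕ) : ℝ) * (crad (sideP (F.P K) Mc ρ) ρ : ℕ) *
      ((1 + 2 * ((((F.P K).L : ℝ) ^ 2 + 6 * ((((F.P K).d + 2) * (F.P K).L : ℕ) : ℝ) ^ 2) * (4 * (((((F.P K).d - 1 : ℕ) : ℝ)) * ((2 * (F.P K).L - 1 : ℕ) : ℝ)) + 1))) * δ (m + 1)) :=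
    mul_nonneg hX0 (mul_nonneg hCL0 hδj.le)
  have hτ00 : (0 : ℝ) ≤ (((F.P K).d * ((F.P K).L - 1) + 1 : ℕ) : ℝ) * (((((F.P K).d - 1 : ℕ) : ℝ) * (((F.P K).L - 1 : ℕ) : ℝ))) := by positivity
  have hτ0 : (0 : ℝ) ≤ (((F.P K).d * ((F.P K).L - 1) + 1 : ℕ) : ℝ) * (((((F.P K).d - 1 : ℕ) : ℝ) * (((F.P K).L - 1 : ℕ) : ℝ)) * δ m) := by positivity
  have hf0 : (0 : ℝ) ≤ 2 * ((((F.P K).d + 2) * (F.P K).L : ℕ) : ℝ) *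
      ((((F.P K).d * ((F.P K).L - 1) + 1 : ℕ) : ℝ) * (((((F.P K).d - 1 : ℕ) : ℝ) * (((F.P K).L - 1 : ℕ) : ℝ)) * δ m)) := by positivity
  -- the frame budget `600ℓ·τ_rad(δ_m) ≤ 1` from the guard on `a₁`
  have hτ1 : 600 * ((((F.P K).d + 2) * (F.P K).L : ℕ) : ℝ) *
      ((((F.P K).d * ((F.P K).L - 1) + 1 : ℕ) : ℝ) * (((((F.P K).d - 1 : ℕ) : ℝ) * (((F.P K).L - 1 : ℕ) : ℝ)) * δ m)) ≤ 1 := by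
    have h1 : (((F.P K).d * ((F.P K).L - 1) + 1 : ℕ) : ℝ) * (((((F.P K).d - 1 : ℕ) : ℝ) * (((F.P K).L - 1 : ℕ) : ℝ)) * δ m) ≤
        (((F.P K).d * ((F.P K).L - 1) + 1 : ℕ) : ℝ) * (((((F.P K).d - 1 : ℕ) : ℝ) * (((F.P K).L - 1 : ℕ) : ℝ)) * a₁) := by
      have := mul_le_mul_of_nonneg_left hδma hτ00
      linarith [this]
    exact le_trans (mul_le_mul_of_nonneg_left h1 (by positivity)) hτ
  -- ### the witness of the normalisation: `w` residual + radial tower, `h` the rooted top axial gauge, `gw = h̄·w`, the clause on the cells of `D̃`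
  obtain ⟨w, hres, hax, hnorm⟩ := hN
  set Dw := domainsMeet (cubeDomains (F.P K) (cornerP (F.P K) Mc ρ idx - ((ρ : ℕ) : Pt (F.P K).d)) (sideP (F.P K) Mc ρ + 2 * ρ) ρ (m + 1) hk)
    (domainsOfSeq s.Ω (m + 1) hk) with hDw
  set h : GaugeTransf (F.P K) (m + 1) (SU N) := axialGaugeAt (Averaging.iter (avOfRecord F N K) (m + 1) (gaugeAct w U))
    (tLo (cornerP (F.P K) Mc ρ idx) ρ) (tHi (cornerP (F.P K) Mc ρ idx) (sideP (F.P K) Mc ρ) ρ) (ctr (cornerP (F.P K) Mc ρ idx) (sideP (F.P K) Mc ρ)) with hh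
  set gw : GaugeTransf (F.P K) 0 (SU N) := fun x => blockLift (m + 1) h x * w x with hgw
  have hcl : ∀ (V : (i : ℕ) → Site (F.P K) i → (Matrix (Fin N) (Fin N) ℂ)ˣ), (∀ x, V 0 x = 1) →
      (∀ (i : ℕ) (y : Site (F.P K) (i + 1)), V (i + 1) y = V i (emb y) * vframeU (dbarIterU i (unitsField (toUField (gaugeAct u U)))) y) →
      ∀ (i : ℕ) (y : Site (F.P K) i), Dw.LamSite i y → (V i y)⁻¹ * toUT (toMS u i) y = toUT (toMS gw i) y := by
    intro V hV0 hVs i y hy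
    have hik : i ≤ m + 1 := by
      have h1 := Dw.le_of_lamSite hy
      have h2 : Dw.k = min (m + 1) (m + 1) := rfl
      rw [h2, min_self] at h1
      exact h1
    exact hnorm hk V hV0 hVs i hik y hy
  -- the representative `U″ = U^{gw}`: radial tower below the top, top `(M^j U)^h`, same plaquettes as `U`
  set U'' : GaugeField (F.P K) 0 (SU N) := gaugeAct gw U with hU''
  have hU''2 : U'' = gaugeAct (blockLift (m + 1) h) (gaugeAct w U) := by
    rw [hU'', hgw, ← T3UnitLawGaugeInvariance.gaugeAct_gaugeAct]
  have hresid : Averaging.iter (avOfRecord F N K) (m + 1) (gaugeAct w U) = Averaging.iter (avOfRecord F N K) (m + 1) U :=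
    iter_gaugeAct_of_isResidual (avOfRecord F N K) hk hres U
  have htower : AxialGauge (radialContourData (F.P K) m (SU N)) (Averaging.iter (avOfRecord F N K) m U'') := by
    rw [hU''2]; exact radialTower_gaugeAct_blockLift F N K hk h (gaugeAct w U) hax m (Nat.lt_succ_self m)
  have htop : Averaging.iter (avOfRecord F N K) (m + 1) U'' = gaugeAct h (Averaging.iter (avOfRecord F N K) (m + 1) U) := by
    rw [hU''2, iter_gaugeAct_blockLift (avOfRecord F N K) hk h (gaugeAct w U), hresid]
  have hplaq : ∀ q : Plaq (F.P K) m, dist1 (GaugeField.plaqHol (Averaging.iter (avOfRecord F N K) m U'') q) =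
      dist1 (GaugeField.plaqHol (Averaging.iter (avOfRecord F N K) m U) q) :=
    fun q => dist1_plaqHol_iter_gaugeAct (F := F) (N := N) (K := K) (by omega : m ≤ (F.P K).m + (F.P K).K) gw U q
  -- ### geometry of the bond: a `D̃`-constraint bond (93 §3); collar labels of its two ends (78); the box bond of the window (62″)
  have hlt'' : m + 1 < (domainsMeet (cubeDomains (F.P K) (cornerP (F.P K) Mc ρ idx) (sideP (F.P K) Mc ρ) ρ (m + 1) hk) (domainsOfSeq s.Ω (m + 1) hk)).k + 1 := by
    show m + 1 < min (m + 1) (m + 1) + 1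
    rw [min_self]; exact Nat.lt_succ_self _
  have hcw : Dw.LamBond (m + 1) c := lamBond_wide_of_near s idx hk ⟨⟨⟨m + 1, hlt''⟩, c⟩, hc⟩ (Or.inl rfl)
  obtain ⟨sl, sl', hsrc, htgt, hsl, hsl'⟩ := exists_collar_labels_of_lamBond_meet (domainsOfSeq s.Ω (m + 1) hk) (by omega : 1 ≤ m + 1) le_rfl hc
  have hIcc := Icc_chartBox_subset_Icc_printWindow (F.P K).L (cornerP (F.P K) Mc ρ idx) (sideP (F.P K) Mc ρ) hρ (m + 1)
  have hslI : sl ∈ Set.Icc (sqLo (F.P K).L (cornerP (F.P K) Mc ρ idx) ρ (m + 1) (m + 1) - 1) (sqHi (F.P K).L (cornerP (F.P K) Mc ρ idx) (sideP (F.P K) Mc ρ) ρ (m + 1) (m + 1) + 1) :=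
    ⟨fun i => (hsl i).1, fun i => (hsl i).2⟩
  have hslI' : sl' ∈ Set.Icc (sqLo (F.P K).L (cornerP (F.P K) Mc ρ idx) ρ (m + 1) (m + 1) - 1) (sqHi (F.P K).L (cornerP (F.P K) Mc ρ idx) (sideP (F.P K) Mc ρ) ρ (m + 1) (m + 1) + 1) :=
    ⟨fun i => (hsl' i).1, fun i => (hsl' i).2⟩
  have hslw : sl ∈ Set.Icc (tLo (cornerP (F.P K) Mc ρ idx) ρ) (tHi (cornerP (F.P K) Mc ρ idx) (sideP (F.P K) Mc ρ) ρ) := hIcc hslI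
  have hslw' : sl' ∈ Set.Icc (tLo (cornerP (F.P K) Mc ρ idx) ρ) (tHi (cornerP (F.P K) Mc ρ idx) (sideP (F.P K) Mc ρ) ρ) := hIcc hslI'
  -- ### the reads of the Landau copy under the two blocks of `c` (95 §3)
  have hη0 : 0 ≤ (F.P K).eta (m + 1) := by unfold Params.eta; positivity
  have hpow : (m + 1) - (m + 1 - 1) = 1 := by omega
  have hsA0 : 0 ≤ κ * ε' * ((F.P K).L : ℝ) := by positivity
  have hηsA : (F.P K).eta (m + 1) * (κ * ε' * ((F.P K).L : ℝ)) ≤ 1 := by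
    have hη1 : (F.P K).eta (m + 1) ≤ 1 := by
      unfold Params.eta
      exact pow_le_one₀ (by positivity) (inv_le_one_of_one_le₀ (by exact_mod_cast (F.P K).L_pos))
    have hℓ1 : (1 : ℝ) ≤ ((((F.P K).d + 2) * (F.P K).L : ℕ) : ℝ) := by
      exact_mod_cast Nat.one_le_iff_ne_zero.mpr (Nat.mul_ne_zero (by omega) (by have := (F.P K).hL.2; omega))
    have hℓ2 : (1 : ℝ) ≤ ((((F.P K).d + 2) * (F.P K).L : ℕ) : ℝ) ^ 2 := one_le_pow₀ hℓ1
    have h1 : κ * ε' * ((F.P K).L : ℝ) ≤ 1 := by nlinarith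
    nlinarith
  have hreads : ∀ b : PBond (F.P K) 0, (iterBlockOf (m + 1) b.src = c.src ∨ iterBlockOf (m + 1) b.src = c.tgt) →
      (iterBlockOf (m + 1) b.tgt = c.src ∨ iterBlockOf (m + 1) b.tgt = c.tgt) →
      unitsField (toUField (gaugeAct u U)) b = expCfg ((F.P K).eta (m + 1)) A b ∧ ‖A b‖ < κ * ε' * ((F.P K).L : ℝ) ∧
        ‖((unitsField (toUField (gaugeAct u U)) b : (MatA N)ˣ) : MatA N) - 1‖ ≤ 2 * ((F.P K).eta (m + 1) * (κ * ε' * ((F.P K).L : ℝ))) := by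
    intro b hbs hbt
    rw [hsrc, htgt] at hbs hbt
    obtain ⟨h1, h2, h3⟩ := landau_reads_of_tower (k := m + 1) hk hLρ (by omega) le_rfl U u A hη0 hT1 hT2 hsl hsl' b hbs hbt
    rw [hpow, pow_one] at h2 h3
    exact ⟨h1, h2, h3 hηsA⟩
  -- ### the dictionary for `U^u` down the window of `c`, transferred to `U″`
  have hLη : ((F.P K).L : ℝ) ^ (m + 1) * (F.P K).eta (m + 1) = 1 := B12Eq115BackgroundPair.pow_mul_eta (F.P K) (m + 1)
  have hs00 : 0 ≤ 2 * ((F.P K).eta (m + 1) * (κ * ε' * ((F.P K).L : ℝ))) := by positivity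
  have hbud' : 6400 * ((((F.P K).d + 2) * (F.P K).L : ℕ) : ℝ) ^ 2 * ((F.P K).L : ℝ) ^ (m + 1) * (2 * ((F.P K).eta (m + 1) * (κ * ε' * ((F.P K).L : ℝ)))) ≤ 1 := by
    have e : 6400 * ((((F.P K).d + 2) * (F.P K).L : ℕ) : ℝ) ^ 2 * ((F.P K).L : ℝ) ^ (m + 1) * (2 * ((F.P K).eta (m + 1) * (κ * ε' * ((F.P K).L : ℝ)))) =
        12800 * ((((F.P K).d + 2) * (F.P K).L : ℕ) : ℝ) ^ 2 * (κ * ε' * ((F.P K).L : ℝ)) * (((F.P K).L : ℝ) ^ (m + 1) * (F.P K).eta (m + 1)) := by ring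
    rw [e, hLη, mul_one]; exact hbud
  have hgd' : 30 * ((((F.P K).d + 2) * (F.P K).L : ℕ) : ℝ) ^ 2 * ((F.P K).L : ℝ) ^ (m + 1) * (2 * ((F.P K).eta (m + 1) * (κ * ε' * ((F.P K).L : ℝ)))) <
      deltaSU (Fin N) := by
    have e : 30 * ((((F.P K).d + 2) * (F.P K).L : ℕ) : ℝ) ^ 2 * ((F.P K).L : ℝ) ^ (m + 1) * (2 * ((F.P K).eta (m + 1) * (κ * ε' * ((F.P K).L : ℝ)))) =
        60 * ((((F.P K).d + 2) * (F.P K).L : ℕ) : ℝ) ^ 2 * (κ * ε' * ((F.P K).L : ℝ)) * (((F.P K).L : ℝ) ^ (m + 1) * (F.P K).eta (m + 1)) := by ring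
    rw [e, hLη, mul_one]; exact hgd
  have hdict := emlIterU_unitsField_eq_iter_of_reads₂ hk (gaugeAct u U) c hs00 hbud' hgd' (fun b hbs hbt => (hreads b hbs hbt).2.2)
  -- at `c` itself (level `m+1`) and at the in-block bonds of either end (level `m`), for the representative
  have hdictc : emlIterU (m + 1) (unitsField (toUField (gaugeAct gw U))) c = unitsField (toUField (Averaging.iter (avOfRecord F N K) (m + 1) U'')) c :=
    emlIterU_eq_iter_apply_of_gaugeAct (avOfRecord F N K) hk U u gw c (hdict (m + 1) le_rfl c (fun _ hx => Or.inl hx) (fun _ hx => Or.inr hx)).1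
  have hdictb : ∀ (y : Site (F.P K) (m + 1)), (y = c.src ∨ y = c.tgt) → ∀ b : PBond (F.P K) m, blockOf b.src = y → blockOf b.tgt = y →
      emlIterU m (unitsField (toUField (gaugeAct gw U))) b = unitsField (toUField (Averaging.iter (avOfRecord F N K) m U'')) b := by
    intro y hy b hbs hbt
    refine emlIterU_eq_iter_apply_of_gaugeAct (avOfRecord F N K) (by omega) U u gw b (hdict m (by omega) b ?_ ?_).1
    · intro x hx
      rw [iterBlockOf_succ, hx, hbs]
      rcases hy with h1 | h1
      · exact Or.inl h1
      · exact Or.inr h1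
    · intro x hx
      rw [iterBlockOf_succ, hx, hbt]
      rcases hy with h1 | h1
      · exact Or.inl h1
      · exact Or.inr h1
  -- ### the row `r` at `c`: the rooted two-sided Poincaré bound on the window box (62″ §1) with 69b″'s data letter
  have hV := plaqSmallOn_printWindow_iter_of_data F N s hsep hkK hgrid hMc hρ hfloor hδ hcompδ hguard W h7 U hfib (by omega : 1 ≤ m + 1) hjk hjK idx hmeet hclean
  have hS1 : 1 ≤ sideP (F.P K) Mc ρ := by have := le_sideP (P := F.P K) Mc hρ; omega
  obtain ⟨hr1, hr2, -⟩ := ctr_mem (a := cornerP (F.P K) Mc ρ idx) (ρ := ρ) hS1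
  have hNwrap : ∀ κ', (tHi (cornerP (F.P K) Mc ρ idx) (sideP (F.P K) Mc ρ) ρ) κ' + 1 - (tLo (cornerP (F.P K) Mc ρ idx) ρ) κ' < (F.P K).sitesPerDir (m + 1) :=
    fun κ' => by have := hn κ'; omega
  have hNwrap' : ∀ κ', (tHi (cornerP (F.P K) Mc ρ idx) (sideP (F.P K) Mc ρ) ρ) κ' - (tLo (cornerP (F.P K) Mc ρ idx) ρ) κ' < (F.P K).sitesPerDir (m + 1) :=
    fun κ' => by have := hn κ'; omega
  have hsrc' : c.src ∈ (castSite '' Set.Icc (tLo (cornerP (F.P K) Mc ρ idx) ρ) (tHi (cornerP (F.P K) Mc ρ idx) (sideP (F.P K) Mc ρ) ρ) : Set (Site (F.P K) (m + 1))) :=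
    ⟨sl, hslw, hsrc.symm⟩
  have htgt' : c.tgt ∈ (castSite '' Set.Icc (tLo (cornerP (F.P K) Mc ρ idx) ρ) (tHi (cornerP (F.P K) Mc ρ idx) (sideP (F.P K) Mc ρ) ρ) : Set (Site (F.P K) (m + 1))) :=
    ⟨sl', hslw', htgt.symm⟩
  have hcB := mem_boxBonds_of_ends_mem_box (P := F.P K) hNwrap hsrc' htgt'
  have hrow : dist1 (Averaging.iter (avOfRecord F N K) (m + 1) U'' c) ≤
      (((F.P K).d - 1 : ℕ) : ℝ) * (crad (sideP (F.P K) Mc ρ) ρ : ℕ) *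
        ((1 + 2 * ((((F.P K).L : ℝ) ^ 2 + 6 * ((((F.P K).d + 2) * (F.P K).L : ℕ) : ℝ) ^ 2) * (4 * (((((F.P K).d - 1 : ℕ) : ℝ)) * ((2 * (F.P K).L - 1 : ℕ) : ℝ)) + 1))) *
          δ (m + 1)) := by
    rw [htop, hh, hresid]
    exact dist1_gaugeAct_axialGaugeAt_le_of_mem_boxBonds (Averaging.iter (avOfRecord F N K) (m + 1) U) subset_rfl hV (mul_nonneg hCL0 hδj.le) hNwrap' hr1 hr2
      (fun x hx hx' κ' => abs_sub_ctr_le_crad hS1 x hx hx' κ') hcB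
  -- ### the frame letter `τ_rad(δ_m)` on the block of an out-end (81's data letter on a window label off `Γ_j`, 71's within row at `U″`)
  have hNm : (F.P K).L < (F.P K).sitesPerDir m := by have := two_mul_L_lt_sitesPerDir (P := F.P K) (m := m) (by omega); omega
  have hframe : ∀ (y : Site (F.P K) (m + 1)) (t : Pt (F.P K).d), y = coverAt (F.P K) (m + 1) t →
      t ∈ Set.Icc (tLo (cornerP (F.P K) Mc ρ idx) ρ) (tHi (cornerP (F.P K) Mc ρ idx) (sideP (F.P K) Mc ρ) ρ) →
      t ∈ Set.Icc (sqLo (F.P K).L (cornerP (F.P K) Mc ρ idx) ρ (m + 1) (m + 1) - 1) (sqHi (F.P K).L (cornerP (F.P K) Mc ρ idx) (sideP (F.P K) Mc ρ) ρ (m + 1) (m + 1) + 1) →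
      y ∉ Dw.Om (m + 1) →
      ∀ b : PBond (F.P K) m, blockOf b.src = y → blockOf b.tgt = y →
        dist1 (Averaging.iter (avOfRecord F N K) m U'' b) ≤
          (((F.P K).d * ((F.P K).L - 1) + 1 : ℕ) : ℝ) * (((((F.P K).d - 1 : ℕ) : ℝ) * (((F.P K).L - 1 : ℕ) : ℝ)) * δ m) := by
    intro y t hyt htw htbox hout b hbs hbt
    have hdent : (castSite t : Site (F.P K) (m + 1)) ∉ genSet s.Ω k (m + 1) :=
      not_mem_genSet_of_not_mem_wideOm s hkK hgrid (by omega) hjk hk idx htw (by rw [← hyt]; exact hout)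
    have hA := plaqSmallOn_dentBlock_iter_of_data F N s hsep hkK hgrid hMc hρ hfloor W h7 U hfib hjk hk idx hmeet hclean t htbox hdent
    have hW : PlaqSmallOn (boxPlaqs (fun i => ((F.P K).L : ℤ) * t i) (fun i => ((F.P K).L : ℤ) * t i + (((F.P K).L : ℤ) - 1))) (δ m)
        (Averaging.iter (avOfRecord F N K) m U'') := by
      intro q hq; rw [hplaq q]; exact hA q hq
    have hsrcb : blockOf b.src = (castSite t : Site (F.P K) (m + 1)) := by rw [hbs, hyt]; rfl
    have htgtb : blockOf b.tgt = (castSite t : Site (F.P K) (m + 1)) := by rw [hbt, hyt]; rfl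
    exact dist1_iter_within_le_of_box (by omega) U'' htower hδm.le hNm t hW b hsrcb htgtb
  -- ### the three cases of the two ends IN `D̃`
  have hendcases : ∀ (y : Site (F.P K) (m + 1)), (y = c.src ∨ y = c.tgt) →
      Dw.LamSite (m + 1) y ∨ (y ∉ Dw.Om (m + 1) ∧ ∀ z : Site (F.P K) m, blockOf z = y → Dw.LamSite m z) := by
    intro y hy
    by_cases hmem : y ∈ Dw.Om (m + 1)
    · refine Or.inl ⟨hmem, Dw.not_deep_of_le ?_ y⟩
      show min (m + 1) (m + 1) ≤ m + 1
      rw [min_self]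
    · rcases lamSite_or_forall_block_of_lamBond_end Dw hAdm hRM hcw hy with hcell | hblock
      · exact absurd hcell.1 hmem
      · exact Or.inr ⟨hmem, hblock⟩
  refine le_envelope_of_three_cases hr0 hf0 ?_
  rcases hendcases c.src (Or.inl rfl) with hs | ⟨hsout, hsblk⟩ <;> rcases hendcases c.tgt (Or.inr rfl) with ht | ⟨htout, htblk⟩
  · -- cell – cell
    exact Or.inl (norm_dbar_sub_one_le_of_cells Dw U u gw hcl c hs ht _ hdictc hrow)
  · -- cell – out-end (target)
    exact Or.inr (Or.inl (norm_dbar_sub_one_le_of_outEnd_tgt Dw U u gw hcl (by omega) c hs htblk _ hdictc hrow _ (hdictb c.tgt (Or.inr rfl)) hτ0 hτ1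
      (hframe c.tgt sl' htgt hslw' hslI' htout)))
  · -- out-end (source) – cell
    exact Or.inr (Or.inr (norm_dbar_sub_one_le_of_outEnd_src Dw U u gw hcl (by omega) c ht hsblk _ hdictc hrow _ (hdictb c.src (Or.inl rfl)) hτ0 hτ1
      (hframe c.src sl hsrc hslw hslI hsout)))
  · -- two out-ends: impossible for a constraint bond at the top of `D̃`
    exfalso
    rcases hcw.1 with h1 | h1
    · exact hsout h1
    · exact htout h1

end Record

end Summit.QuantumFields.YangMills.BalabanUVNodes.N07DbarNearRowsTop

end
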